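import Mathlib
import Summits.PneNP.PneNP.Theorems.CnfIdealGenLengthRankDefectRepresentationsCutLemma
import Summits.PneNP.PneNP.Theorems.CnfIdealGenLengthRankDefectRepresentationsTwoFamilyCutDomination

/-!
# Crux `RankDefectRepresentations` (stmt-PneNP-18923), line `rank-dehn-ladder`: the 2D max-cut decomposition when the second
# family has ONE coordinate (two colour classes) — base case of the registered stub `stub_doubleMaxCutDecomposition` (lead g9)

`DoubleMaxCutDecomposition K n n' λ` (`Theorems/…TwoFamilyCutDomination`, p653152): if every DOUBLE BIPARTITION CUT of a matrix `D`
whose rows and columns are coloured by `{0,1}^n × {0,1}^{n'}` has rank `≤ c`, then `D = S_I + S_J + L` with `S_I` supported on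
"first-family colours agree", `S_J` on "second-family colours agree" and `rank L ≤ λ c`.  Here we prove it for `n' = 1` with the
absolute constant `λ = 8` (`doubleMaxCutDecomposition_one`): put the entries with equal second colour into `S_J`; what is left is the
sum of the two "second colours differ" blocks, each of which is a ONE-family instance whose bipartition cuts are dominated by the double
cuts with `B' = {second colour = 0}`, so g7's max-cut decomposition (`exists_blockDiagonal_of_maxCut`, p642852) writes each as
(first-family block-diagonal) + (rank `≤ 4c`).  Tool of independent use: `exists_blockDiagonal_of_cuts_le` (the max-cut decomposition
stated with a uniform cut bound `c` — the maximiser is produced inside).  The general stub asks for `λ` polynomial in `n + n'`;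
this file is its `n' = 1` slice (by the symmetry of the definition the `n = 1` slice is the same argument).
HONEST FRAMING: elementary negative-lane tool; P ≠ NP is not moved; F-N2 is a FRONTIER formal rung.
-/

set_option linter.dupNamespace false -- `Summit.PneNP.PneNP.…`: summit = sub-problem name (D-0017)

namespace Summit.PneNP.PneNP.Theorems.CnfIdealGenLengthRankDefectRepresentationsDoubleMaxCutTwoClasses

open Matrix Finset
open Summit.PneNP.PneNP.Theorems.CnfIdealGenLengthRankDefectRepresentationsMergeLowerBound (rank_add_le')
open Summit.PneNP.PneNP.Theorems.CnfIdealGenLengthRankDefectRepresentationsCutLemma (exists_blockDiagonal_of_maxCut)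
open Summit.PneNP.PneNP.Theorems.CnfIdealGenLengthRankDefectRepresentationsCutLemmaMaxCut (rank_rowZero_le rank_colZero_le)
open Summit.PneNP.PneNP.Theorems.CnfIdealGenLengthRankDefectRepresentationsTwoFamilyCutDomination
  (colourI colourJ maskJ doubleCut DoubleMaxCutDecomposition)

variable {K : Type} [Field K]

section MaxCut

variable {ι ι' Q : Type} [Fintype ι] [Fintype ι'] [DecidableEq ι] [DecidableEq ι'] [DecidableEq Q] [Fintype Q]

/-- **Max-cut decomposition with a uniform cut bound.**  If every bipartition cut of the coloured matrix `R` has rank `≤ c`,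
then `R` is within rank `4c` of a matrix supported on the equal-colour cells (g7's `exists_blockDiagonal_of_maxCut` applied at a
maximiser of the cut function, which exists because there are finitely many colour sets). [folklore] -/
theorem exists_blockDiagonal_of_cuts_le (row : ι → Q) (col : ι' → Q) (R : Matrix ι ι' K) (c : ℕ)
    (hc : ∀ B' : Finset Q,
      (Matrix.of fun x y => if row x ∈ B' ∧ col y ∉ B' then R x y else 0).rank +
        (Matrix.of fun x y => if row x ∉ B' ∧ col y ∈ B' then R x y else 0).rank ≤ c) :
    ∃ R' : Matrix ι ι' K, (∀ x y, row x ≠ col y → R' x y = 0) ∧ (R - R').rank ≤ 4 * c := by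
  classical
  let μ : Finset Q → ℕ := fun B' =>
    (Matrix.of fun x y => if row x ∈ B' ∧ col y ∉ B' then R x y else 0).rank +
      (Matrix.of fun x y => if row x ∉ B' ∧ col y ∈ B' then R x y else 0).rank
  obtain ⟨B, -, hB⟩ :=
    Finset.exists_max_image (Finset.univ : Finset (Finset Q)) μ Finset.univ_nonempty
  obtain ⟨R', h1, h2⟩ := exists_blockDiagonal_of_maxCut row col R B (fun B' => hB B' (Finset.mem_univ _))
  exact ⟨R', h1, h2.trans (Nat.mul_le_mul_left 4 (hc B))⟩

end MaxCut

section TwoClasses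

variable {n : ℕ} {ι ι' : Type} [Fintype ι] [Fintype ι'] [DecidableEq ι] [DecidableEq ι']

/-- With one second-family coordinate, the second-family colour class of an index is the single bit `c (inr 0)`:
membership in `{0}` (the all-`false` class) is `c (inr 0) = false`. -/
theorem colourJ_mem_singleton_iff (c : Fin n ⊕ Fin 1 → Bool) :
    colourJ c ∈ ({fun _ => false} : Finset (Fin 1 → Bool)) ↔ c (Sum.inr 0) = false := by
  rw [Finset.mem_singleton]
  constructor
  · intro h; exact congrFun h 0
  · intro h; funext k; rw [Subsingleton.elim k 0]; exact h

/-- **The 2D max-cut decomposition for two second-family classes** (`n' = 1`), absolute constant `8`. -/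
theorem doubleMaxCutDecomposition_one (K : Type) [Field K] (n : ℕ) : DoubleMaxCutDecomposition K n 1 8 := by
  classical
  intro ι ι' _ _ _ _ row col D c hc
  -- second-family bit of a row / column
  set qr : ι → Bool := fun x => row x (Sum.inr 0) with hqr
  set qc : ι' → Bool := fun y => col y (Sum.inr 0) with hqc
  set B0 : Finset (Fin 1 → Bool) := {fun _ => false} with hB0
  -- the mask of `B0` keeps exactly the entries whose second bits differ
  have hmask : maskJ row col B0 D = Matrix.of fun x y => if qr x ≠ qc y then D x y else 0 := by
    ext x y
    simp only [maskJ, Matrix.of_apply, hB0, colourJ_mem_singleton_iff, hqr, hqc]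
    by_cases h1 : row x (Sum.inr 0) = false <;> by_cases h2 : col y (Sum.inr 0) = false <;>
      simp_all
  -- the two "second bits differ" blocks
  set M01 : Matrix ι ι' K := Matrix.of fun x y => if qr x = false ∧ qc y = true then D x y else 0 with hM01
  set M10 : Matrix ι ι' K := Matrix.of fun x y => if qr x = true ∧ qc y = false then D x y else 0 with hM10
  set SJ : Matrix ι ι' K := Matrix.of fun x y => if qr x = qc y then D x y else 0 with hSJ
  have hD : D = SJ + M01 + M10 := by
    ext x y
    simp only [hSJ, hM01, hM10, Matrix.add_apply, Matrix.of_apply]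
    cases h1 : qr x <;> cases h2 : qc y <;> simp
  -- first-family colourings
  set rI : ι → (Fin n → Bool) := fun x => colourI (row x) with hrI
  set cI : ι' → (Fin n → Bool) := fun y => colourI (col y) with hcI
  -- every bipartition cut of `M01` (and of `M10`) is dominated by the double cut at `(B, B0)`
  have hcut : ∀ (M : Matrix ι ι' K) (p : ι → Prop) (q : ι' → Prop) [DecidablePred p] [DecidablePred q],
      (M = Matrix.of fun x y => if p x ∧ q y then maskJ row col B0 D x y else 0) →
      ∀ B : Finset (Fin n → Bool),
        (Matrix.of fun x y => if rI x ∈ B ∧ cI y ∉ B then M x y else 0).rank +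
          (Matrix.of fun x y => if rI x ∉ B ∧ cI y ∈ B then M x y else 0).rank ≤ c := by
    intro M p q _ _ hM B
    have key : ∀ (P : ι → Prop) (P' : ι' → Prop) [DecidablePred P] [DecidablePred P'],
        (Matrix.of fun x y => if P x ∧ P' y then M x y else 0).rank ≤
          (Matrix.of fun x y => if P x ∧ P' y then maskJ row col B0 D x y else 0).rank := by
      intro P P' _ _
      set N : Matrix ι ι' K := Matrix.of fun x y => if P x ∧ P' y then maskJ row col B0 D x y else 0 with hN
      have e : (Matrix.of fun x y => if P x ∧ P' y then M x y else 0) =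
          Matrix.of fun x y => if p x then (Matrix.of fun x y => if q y then N x y else 0) x y else 0 := by
        ext x y
        simp only [hM, hN, Matrix.of_apply]
        by_cases a1 : P x <;> by_cases a2 : P' y <;> by_cases a3 : p x <;> by_cases a4 : q y <;> simp [a1, a2, a3, a4]
      rw [e]
      exact (rank_rowZero_le p _).trans (rank_colZero_le q N)
    have h := hc B B0
    unfold doubleCut at h
    have k1 := key (fun x => rI x ∈ B) (fun y => cI y ∉ B)
    have k2 := key (fun x => rI x ∉ B) (fun y => cI y ∈ B)
    simp only [hrI, hcI] at k1 k2 ⊢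
    omega
  have hM01' : M01 = Matrix.of fun x y => if qr x = false ∧ qc y = true then maskJ row col B0 D x y else 0 := by
    rw [hmask]; ext x y
    simp only [hM01, Matrix.of_apply]
    cases h1 : qr x <;> cases h2 : qc y <;> simp
  have hM10' : M10 = Matrix.of fun x y => if qr x = true ∧ qc y = false then maskJ row col B0 D x y else 0 := by
    rw [hmask]; ext x y
    simp only [hM10, Matrix.of_apply]
    cases h1 : qr x <;> cases h2 : qc y <;> simp
  obtain ⟨S₁, hS₁, hL₁⟩ := exists_blockDiagonal_of_cuts_le rI cI M01 c
    (hcut M01 (fun x => qr x = false) (fun y => qc y = true) hM01')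
  obtain ⟨S₂, hS₂, hL₂⟩ := exists_blockDiagonal_of_cuts_le rI cI M10 c
    (hcut M10 (fun x => qr x = true) (fun y => qc y = false) hM10')
  refine ⟨S₁ + S₂, SJ, ?_, ?_, ?_⟩
  · -- `S_I` vanishes where some first-family coordinate differs
    rintro x y ⟨k, hk⟩
    have hne : rI x ≠ cI y := by
      intro h; exact hk (by simpa [hrI, hcI, colourI] using congrFun h k)
    rw [Matrix.add_apply, hS₁ x y hne, hS₂ x y hne, add_zero]
  · -- `S_J` vanishes where the (only) second-family coordinate differs
    rintro x y ⟨k', hk'⟩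
    have hk0 : k' = 0 := Subsingleton.elim _ _
    subst hk0
    have : qr x ≠ qc y := hk'
    simp [hSJ, this]
  · have e : D - (S₁ + S₂) - SJ = (M01 - S₁) + (M10 - S₂) := by rw [hD]; abel
    rw [e]
    calc ((M01 - S₁) + (M10 - S₂)).rank ≤ (M01 - S₁).rank + (M10 - S₂).rank := rank_add_le' _ _
      _ ≤ 4 * c + 4 * c := Nat.add_le_add hL₁ hL₂
      _ = 8 * c := by ring

end TwoClasses

end Summit.PneNP.PneNP.Theorems.CnfIdealGenLengthRankDefectRepresentationsDoubleMaxCutTwoClasses
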